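import Summits.BirchSwinnertonDyer.BirchSwinnertonDyer.Theses.ByReductionTypeAtTwo
import Summits.BirchSwinnertonDyer.BirchSwinnertonDyer.Theorems.ByReductionTypeAtTwoSupersingularUniformFlatLine
import Summits.BirchSwinnertonDyer.BirchSwinnertonDyer.Theorems.ByReductionTypeAtTwoSupersingularFlatBlindEulerChar
import Summits.BirchSwinnertonDyer.BirchSwinnertonDyer.Theorems.ByReductionTypeAtTwoSupersingularFlatBlindNoCotorsion
import Summits.BirchSwinnertonDyer.BirchSwinnertonDyer.Theorems.ByReductionTypeAtTwoSupersingularFlatBlindLocalTransversalityApZero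
import Summits.BirchSwinnertonDyer.Rank1Residual.F1Sign2.HondaSystemAtTwo
import Summits.BirchSwinnertonDyer.Rank1Residual.Supersingular.BlindControlTwo
import Summits.BirchSwinnertonDyer.Rank1Residual.Supersingular.BlindPointDerivAt
import Summits.BirchSwinnertonDyer.Rank1Residual.P2.EmptyCellsAtTwo
import Literature.NumberTheory.EllipticCurves.PadicFormalLogOrder
import Literature.NumberTheory.EllipticCurves.QuadraticTwist
import Literature.NumberTheory.EllipticCurves.Rank1Residual.Predicates
import Literature.NumberTheory.EllipticCurves.AnalyticRankOrderProofs
import Summits.BirchSwinnertonDyer.BirchSwinnertonDyer.Theorems.ByReductionTypeAtTwoSupersingularFlatBlindLocalTransversality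
import HarnessLib

/-!
# D-imc-72 (cell `bsd-f1-sign2`, seat `-imc` g29): THE BLIND KERNEL IS EXPLICIT at `a₂ = ±2` —
# two typed sub-targets and the kernel-checked reduction of the line's rung CDF±_H
# (`OddBlindPackage.FlatBlindLocalTransversalityHondaOffZeroAtTwo`, `Lines/odd_blind_package.lean` v2.6 §4b — copied here verbatim)

HONEST FRAMING.  PUBLISH-ONLY workfile (planner, `ledger crux write`; no registry verb, no proposal); two `def … : Prop`
(nothing asserted about any curve) + a verbatim copy of the line's CDF±_H, and ONE sorry-free theorem of pure logic + the tree's `p = 2` identity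
`OddBlindLocal.evalAt_negTwo_sharp_of_isColemanPair_of_mem` (LEAD ss-1 GEN 18, p800827).  Nothing booked; BSD is proved
for no curve.  bears_on: K4 crux `SupersingularRankZeroAtTwo` (item stmt-BirchSwinnertonDyer-19097), slot 5 `stub_CD`,
local conjunct CDF± at `a₂ ≠ 0` under the Honda hypothesis (rung CDF±_H).  MEMO-imc §10.111 (D-imc-72).

## The split (model theorem behind it: MEMO-imc §10.101 Lemma 61.A + §10.111 (2))

In the two-generation Honda model at `(p, a_p) = (2, ±2)` the ♭-blind kernel of Sprung's Coleman map is the explicit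
rank-one `Λ`-module `Ker Col♭ = {w_f : f ∈ TΛ}` with `Col♯(w_f) = f`; in particular the Coleman pair `(T, 0)` is
REALISED by an integral functional `w_T` on `E(ℚ_{∞,v})` (exact certificate: `MEMO-imc-data/dimc72/OUT-d72.txt`,
`a = ±2`, depth `5`).  Read in the tree's vocabulary this is the first sub-target:

* (G) `HondaBlindGeneratorAtTwo` — for a Honda system `c` at `2` with `a₂ ≠ 0`: `∃ z, IsColemanPair κ ι W a₂ g c z X 0`.

By p800827's level-one identity (`ω₁(−2) = 0`, `u₁ = 1`, `v₁ = 0`), such a `z` lies in `Ker Col♭` and has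
`z(g·c₁) − z(c₁) = X(−2) = −2`.  The second sub-target is the FIRST-LAYER arithmetic that turns this one value into
the INDEX form of CDF± (no Coleman theory in it):

* (Y) `FirstLayerTwistDetectionAtTwo` — for the same data: EVERY additive `z : E(ℚ_{∞,v}) → ℤ₂` with
  `z(g·c₁) − z(c₁) = −2` detects every ψ₂-vector `y` of the first layer to the typed exponent:
  `y ∉ 2^k·E(ℚ_{1,v}) ⟹ 2^{k+1} ∤ z(y)`.  (Why true: `E(ℚ_{1,v}) = E(ℚ₂(√2))` has no `2`-torsion and its
  `g = −1` part `Y` is a free `ℤ₂`-module of rank one, `Y = ℤ₂·y₀`; `(g−1)c₁ = δ·y₀ ∈ Y` and `z((g−1)c₁) = −2` give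
  `v₂(δ) + v₂(z(y₀)) = 1`, so `v₂(z(y₀)) ≤ 1` and `v₂(z(2^j u y₀)) ≤ j + 1 ≤ k` for `j < k`.  In the Honda model
  `δ = −2` exactly and `w_T(y₀) = 1`.)

* ★ `flatBlindLocalTransversalityHondaOffZeroAtTwo_of_generator : (G) → (Y) → CDF±_H` (kernel-checked below).

Sizes for provers: (G) = M (layerwise construction of `w_T` from the generation clauses of `IsHondaSystemAtTwo`,
character formula for `P_n(z; c_n)` — diagonal in the layer index, `Φ_i(χ_j) = 2` for `i > j` — and
`u_j(χ_j) ≠ 0`, MEMO-imc §10.101 Thm 61.2); (Y) = S–M (structure of `E(ℚ₂(√2)) ⊗ ℤ₂` under `Gal(ℚ₂(√2)/ℚ₂)`: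
formal logarithm + no `2`-torsion, tree `SignedIntersection.noTwoTorsion_localTowerPointsOfEmb_adicCompletion`;
or directly from the level-`1` generation clause).  Why (G) might fail outside the model: only through a mismatch
between the model's reading of Sprung (7.3)–(7.5) and the tree's `IsColemanPair` at level `0`
(`ω₀ = T`: the clause reads `z(c₀) = −u₀(0)·L♯(0) − v₀(0)·L♭(0) = 0` for the pair `(T, 0)`, and indeed `w_T` kills
the level-`0` line `V₀ ∋ c₀ = (a² − 2a − 1)·ε`, Lemma 61.A (iii)).

## References
* [Sprung2012] F. Sprung, J. Number Theory 132 (2012): Def. 5.9 (p. 1495), Def. 7.1–7.2, Prop. 7.3 (p. 1500),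
  Def. 7.9 (p. 1503), Open Problem 7.22 (p. 1505); Thm. 2.2 (p. 1487) for the Honda system.
* [Sprung2017] F. Sprung, ANT 11 (2017), Cor. 4.4 (`u₁ = 1`, `v₁ = 0`).
* [Kobayashi2003] S. Kobayashi, Invent. Math. 152 (2003), Prop. 8.12, Thm. 8.3 (Honda theory at `2`).
* Tree: `Sprung2012/ColemanMaps.lean` (`IsColemanPair`, `colemanKer`), `F1Sign2/HondaSystemAtTwo.lean`
  (`IsHondaSystemAtTwo`), `Theorems/ByReductionTypeAtTwoSupersingularFlatBlindLocalTransversality.lean` (p800827),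
  `Cruxes/SupersingularRankZeroAtTwo/Lines/odd_blind_package.lean` v2.6 (commit 6113576e4e71) §4b.
-/

set_option autoImplicit false
set_option linter.dupNamespace false
set_option linter.unusedVariables false

noncomputable section

open scoped Classical NumberField
open NumberField IsDedekindDomain WeierstrassCurve PowerSeries
open Literature.NumberTheory.EllipticCurves Literature.NumberTheory.EllipticCurves.IwasawaDual
  Literature.NumberTheory.EllipticCurves.Sprung2012 Literature.NumberTheory.EllipticCurves.Sprung2017
  Literature.NumberTheory.EllipticCurves.Rank1Residual Literature.NumberTheory.EllipticCurves.Rank1Residual.Typed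
  Literature.NumberTheory.EllipticCurves.Kobayashi2003 Literature.NumberTheory.GaloisRepresentations ZpExtension
open Summit.BirchSwinnertonDyer.Rank1Residual Summit.BirchSwinnertonDyer.Rank1Residual.Supersingular
  Summit.BirchSwinnertonDyer.Rank1Residual.Supersingular.BlindLever

namespace Summit.BirchSwinnertonDyer.BirchSwinnertonDyer.Cruxes.SupersingularRankZeroAtTwo

namespace D72BlindGenerator

/-- **(G) `HondaBlindGeneratorAtTwo`** — the Coleman pair `(T, 0)` is REALISED on a Honda tower at `a₂ ≠ 0`: for
`W/ℚ` globally minimal, good supersingular at `2` with `a₂ ≠ 0` (so `a₂ = ±2`), the cyclotomic `ℤ₂`-extension `κ`,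
`v ∣ 2`, a local `g` restricting to a topological generator, and a system `c` of local points (levels `c n ∈ E(ℚ_{n,v})`)
that is a Honda system at two for some `c_{−1}` (tree `F1Sign2.IsHondaSystemAtTwo`: computed bottom relations, the
generic trace relation, Sprung's two-generation clauses): SOME additive functional `z` on `E(ℚ_{∞,v})` has Coleman
value `(X, 0)` — `Col♯(z) = T`, `Col♭(z) = 0`.  Model: `z = w_T`, the generator of `Ker Col♭ = {w_f : f ∈ TΛ}`
(MEMO-imc §10.101 Lemma 61.A, §10.111 (2); certificate `dimc72/OUT-d72.txt`).  OPEN in the tree; size M.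
Why it might fail: a level-`0` convention mismatch between the model and `IsColemanPair` (see header) — checked
against p800827/p801290 at levels `0, 1`.  Nothing asserted.
[cite: Sprung2012, Def. 5.9 (p. 1495), Def. 7.9 (p. 1503), Open Problem 7.22 (p. 1505)] -/
def HondaBlindGeneratorAtTwo : Prop :=
  ∀ (W : WeierstrassCurve ℚ) [W.IsElliptic] [W.IsGloballyMinimal],
  GoodSS W 2 → W.frobeniusTrace 2 ≠ 0 →
  ∀ (κ : ZpExtension ℚ 2), κ.IsCyclotomic →
  ∀ (v : HeightOneSpectrum (𝓞 ℚ)), (2 : 𝓞 ℚ) ∈ v.asIdeal →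
  ∀ (g : Field.absoluteGaloisGroup (v.adicCompletion ℚ)) (c : ℕ → localPoints W (v.adicCompletion ℚ)),
    κ.IsTopGenerator (resGalOfEmb (closureEmb (K := ℚ) (v.adicCompletion ℚ)) g) →
    (∀ n, c n ∈ localLayerPointsOfEmb κ (closureEmb (K := ℚ) (v.adicCompletion ℚ)) W n) →
    (∃ cneg : localPoints W (v.adicCompletion ℚ),
      Summit.BirchSwinnertonDyer.Rank1Residual.F1Sign2.IsHondaSystemAtTwo κ (closureEmb (K := ℚ) (v.adicCompletion ℚ)) W
        (W.frobeniusTrace 2) g cneg c) →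
    ∃ z : localTowerPointsOfEmb κ (closureEmb (K := ℚ) (v.adicCompletion ℚ)) W →+ ℤ_[2],
      IsColemanPair κ (closureEmb (K := ℚ) (v.adicCompletion ℚ)) W (W.frobeniusTrace 2) g c z PowerSeries.X 0

/-- **(Y) `FirstLayerTwistDetectionAtTwo`** — first-layer arithmetic, no Coleman theory: for the same data, EVERY
additive `z : E(ℚ_{∞,v}) → ℤ₂` with `z(g·c₁) − z(c₁) = −2` detects every ψ₂-vector of the first layer to the exponent
of the line's INDEX form: `y ∈ E(ℚ_{1,v})`, `g·y = −y`, `y ∉ 2^k·E(ℚ_{1,v})` ⟹ `2^{k+1} ∤ z(y)`.  Why true (model /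
expected tree proof): `E(ℚ_{1,v}) = E(ℚ₂(√2))` has no `2`-torsion and `Y := E(ℚ_{1,v})^{g=−1}` is `ℤ₂`-free of
rank one, `Y = ℤ₂·y₀`, `(g−1)c₁ = δ·y₀`; `z((g−1)c₁) = −2` forces `v₂(z(y₀)) ≤ 1`, whence `v₂(z(2^j u y₀)) ≤ j+1 ≤ k`
for `j < k` (Honda model: `δ = −2`, `w_T(y₀) = 1`).  OPEN in the tree; size S–M.  Why it might fail: only if the
first layer's `g = −1` part had `ℤ₂`-rank ≠ 1 (it has rank `1`: `E(ℚ₂(√2)) ⊗ ℚ₂ ≅ ℚ₂[Gal(ℚ₂(√2)/ℚ₂)]` by the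
formal logarithm).  Nothing asserted. [folklore] [cite: Sprung2012, Def. 7.9 (p. 1503)] -/
def FirstLayerTwistDetectionAtTwo : Prop :=
  ∀ (W : WeierstrassCurve ℚ) [W.IsElliptic] [W.IsGloballyMinimal],
  GoodSS W 2 → W.frobeniusTrace 2 ≠ 0 →
  ∀ (κ : ZpExtension ℚ 2), κ.IsCyclotomic →
  ∀ (v : HeightOneSpectrum (𝓞 ℚ)), (2 : 𝓞 ℚ) ∈ v.asIdeal →
  ∀ (g : Field.absoluteGaloisGroup (v.adicCompletion ℚ)) (c : ℕ → localPoints W (v.adicCompletion ℚ)),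
    κ.IsTopGenerator (resGalOfEmb (closureEmb (K := ℚ) (v.adicCompletion ℚ)) g) →
    ∀ (hc : ∀ n, c n ∈ localLayerPointsOfEmb κ (closureEmb (K := ℚ) (v.adicCompletion ℚ)) W n),
    (∃ cneg : localPoints W (v.adicCompletion ℚ),
      Summit.BirchSwinnertonDyer.Rank1Residual.F1Sign2.IsHondaSystemAtTwo κ (closureEmb (K := ℚ) (v.adicCompletion ℚ)) W
        (W.frobeniusTrace 2) g cneg c) →
    ∀ z : localTowerPointsOfEmb κ (closureEmb (K := ℚ) (v.adicCompletion ℚ)) W →+ ℤ_[2],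
      z ⟨g • c 1, smul_mem_localTowerPointsOfEmb κ (closureEmb (K := ℚ) (v.adicCompletion ℚ)) W g
          (localLayerPointsOfEmb_le_localTowerPointsOfEmb κ (closureEmb (K := ℚ) (v.adicCompletion ℚ)) W 1 (hc 1))⟩
        - z ⟨c 1, localLayerPointsOfEmb_le_localTowerPointsOfEmb κ (closureEmb (K := ℚ) (v.adicCompletion ℚ)) W 1 (hc 1)⟩
        = -2 →
    ∀ (y : localPoints W (v.adicCompletion ℚ))
      (hy : y ∈ localLayerPointsOfEmb κ (closureEmb (K := ℚ) (v.adicCompletion ℚ)) W 1), g • y = -y →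
      ∀ k : ℕ, (∀ w ∈ localLayerPointsOfEmb κ (closureEmb (K := ℚ) (v.adicCompletion ℚ)) W 1, 2 ^ k • w ≠ y) →
        ¬ (2 : ℤ_[2]) ^ (k + 1) ∣
          z ⟨y, localLayerPointsOfEmb_le_localTowerPointsOfEmb κ (closureEmb (K := ℚ) (v.adicCompletion ℚ)) W 1 hy⟩

/-- **CDF±_H, VERBATIM COPY** of the line's rung `OddBlindPackage.FlatBlindLocalTransversalityHondaOffZeroAtTwo`
(`Cruxes/SupersingularRankZeroAtTwo/Lines/odd_blind_package.lean` v2.6, commit 6113576e4e71, l.895–924; body byte-identical,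
so the two declarations are definitionally equal and any file importing both bridges them by `Iff.rfl`).  Copied here only
because a `Cruxes/…/Lines/*.lean` workfile is not an importable module on the farm (`remote:stale:unbuilt`).  The pen-pregrade
text of CDF± (`FlatBlindLocalTransversalityOffZeroAtTwo`, @56dc3662d3071f11) with ONE hypothesis inserted after (SAT): the system
is a Honda system at two for some `c_{−1}`.  Nothing asserted. [cite: Sprung2012, Def. 7.9 (p. 1503), Open Problem 7.22 (p. 1505)] -/
def FlatBlindLocalTransversalityHondaOffZeroAtTwo : Prop :=
  ∀ (W : WeierstrassCurve ℚ) [W.IsElliptic] [W.IsGloballyMinimal],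
  ¬ W.HasCM → GoodSS W 2 → W.frobeniusTrace 2 ≠ 0 → W.rootNumber * ZMod.χ₈ (W.conductorNorm ℤ : ZMod 8) = -1 →
  ∀ (κ : ZpExtension ℚ 2) (γ : Field.absoluteGaloisGroup ℚ),
    κ.IsCyclotomic → κ.IsTopGenerator γ → IsCyclotomicVariable 2 γ →
  ∀ (v : HeightOneSpectrum (𝓞 ℚ)), (2 : 𝓞 ℚ) ∈ v.asIdeal →
  ∀ (g : Field.absoluteGaloisGroup (v.adicCompletion ℚ)) (c : ℕ → localPoints W (v.adicCompletion ℚ)),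
    κ.IsTopGenerator (resGalOfEmb (closureEmb (K := ℚ) (v.adicCompletion ℚ)) g) →
    (∀ n, c n ∈ localLayerPointsOfEmb κ (closureEmb (K := ℚ) (v.adicCompletion ℚ)) W n) →
    (∀ n, 1 ≤ n → localTraceOfEmb κ (closureEmb (K := ℚ) (v.adicCompletion ℚ)) W n (n + 1)
      (c (n + 1)) = W.frobeniusTrace 2 • c n - c (n - 1)) →
    (∀ z₀ : localLayerPointsOfEmb κ (closureEmb (K := ℚ) (v.adicCompletion ℚ)) W 0 →+ ℤ_[2],
      evalOn W (localLayerPointsOfEmb κ (closureEmb (K := ℚ) (v.adicCompletion ℚ)) W 0) z₀ (c 0) = 0 →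
        z₀ = 0) →
    (∀ a : ℤ_[2],
      (∃ z₀ : localLayerPointsOfEmb κ (closureEmb (K := ℚ) (v.adicCompletion ℚ)) W 0 →+ ℤ_[2],
        evalOn W (localLayerPointsOfEmb κ (closureEmb (K := ℚ) (v.adicCompletion ℚ)) W 0) z₀ (c 0) = 2 * a) →
      ∃ y : localLayerPointsOfEmb κ (closureEmb (K := ℚ) (v.adicCompletion ℚ)) W 0 →+ ℤ_[2],
        evalOn W (localLayerPointsOfEmb κ (closureEmb (K := ℚ) (v.adicCompletion ℚ)) W 0) y (c 0) = a) →
    (∃ cneg : localPoints W (v.adicCompletion ℚ),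
      Summit.BirchSwinnertonDyer.Rank1Residual.F1Sign2.IsHondaSystemAtTwo κ (closureEmb (K := ℚ) (v.adicCompletion ℚ)) W
        (W.frobeniusTrace 2) g cneg c) →
    ∀ (y : localPoints W (v.adicCompletion ℚ))
      (hy : y ∈ localLayerPointsOfEmb κ (closureEmb (K := ℚ) (v.adicCompletion ℚ)) W 1), g • y = -y →
      ∀ k : ℕ, (∀ w ∈ localLayerPointsOfEmb κ (closureEmb (K := ℚ) (v.adicCompletion ℚ)) W 1, 2 ^ k • w ≠ y) →
        ∃ z ∈ colemanKer κ (closureEmb (K := ℚ) (v.adicCompletion ℚ)) W (W.frobeniusTrace 2) g c .flat,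
          ¬ (2 : ℤ_[2]) ^ (k + 1) ∣
            z ⟨y, localLayerPointsOfEmb_le_localTowerPointsOfEmb κ (closureEmb (K := ℚ) (v.adicCompletion ℚ)) W 1 hy⟩

/-- ★ **(G) ∧ (Y) ⟹ CDF±_H** (the verbatim copy above of the line's rung `OddBlindPackage.FlatBlindLocalTransversalityHondaOffZeroAtTwo`):
take the functional `z` of (G); its Coleman value `(X, 0)` puts it in `Ker Col♭` (`chromaticL .flat X 0 = 0`) and, by
p800827's level-one identity at the zero `−2` of `ω₁` (`OddBlindLocal.evalAt_negTwo_sharp_of_isColemanPair_of_mem`,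
`u₁ = 1`, `v₁ = 0`), `z(g·c₁) − z(c₁) = X(−2) = −2`; then (Y) gives the index form for every ψ₂-vector.  Pure logic +
two tree lemmas; the global binders of CDF±_H (`¬CM`, odd root number, `γ`, the duplicated level-`0`/trace clauses)
are not used. [folklore] [cite: Sprung2012, Def. 5.9 (p. 1495) and Def. 7.9 (p. 1503)] -/
theorem flatBlindLocalTransversalityHondaOffZeroAtTwo_of_generator
    (hG : HondaBlindGeneratorAtTwo) (hY : FirstLayerTwistDetectionAtTwo) :
    FlatBlindLocalTransversalityHondaOffZeroAtTwo := by
  intro W _ _ _hCM hss ha _hodd κ _γ hκ _hγ _hcv v hv g c hg hc _htr _hz _hsat hH y hy hgy k hnd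
  obtain ⟨z, hz⟩ := hG W hss ha κ hκ v hv g c hg hc hH
  have hc1 := localLayerPointsOfEmb_le_localTowerPointsOfEmb κ (closureEmb (K := ℚ) (v.adicCompletion ℚ)) W 1 (hc 1)
  have hid := Theorems.OddBlindLocal.evalAt_negTwo_sharp_of_isColemanPair_of_mem hc1 hz
  rw [evalAt_X] at hid
  refine ⟨z, ⟨PowerSeries.X, 0, hz, rfl⟩, ?_⟩
  exact hY W hss ha κ hκ v hv g c hg hc hH z hid.symm y hy hgy k hnd

/-- (G) alone already gives the QUALITATIVE transversality of p800827 §3 for Honda systems: some `z ∈ Ker Col♭` does not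
kill the ψ₂-vector `(g−1)c₁` (`z(g·c₁) − z(c₁) = −2 ≠ 0`). [folklore] [cite: Sprung2012, Def. 7.9 (p. 1503)] -/
theorem exists_mem_colemanKer_flat_apply_sub_eq_neg_two (hG : HondaBlindGeneratorAtTwo)
    (W : WeierstrassCurve ℚ) [W.IsElliptic] [W.IsGloballyMinimal]
    (hss : GoodSS W 2) (ha : W.frobeniusTrace 2 ≠ 0)
    (κ : ZpExtension ℚ 2) (hκ : κ.IsCyclotomic)
    (v : HeightOneSpectrum (𝓞 ℚ)) (hv : (2 : 𝓞 ℚ) ∈ v.asIdeal)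
    (g : Field.absoluteGaloisGroup (v.adicCompletion ℚ)) (c : ℕ → localPoints W (v.adicCompletion ℚ))
    (hg : κ.IsTopGenerator (resGalOfEmb (closureEmb (K := ℚ) (v.adicCompletion ℚ)) g))
    (hc : ∀ n, c n ∈ localLayerPointsOfEmb κ (closureEmb (K := ℚ) (v.adicCompletion ℚ)) W n)
    (hH : ∃ cneg : localPoints W (v.adicCompletion ℚ),
      Summit.BirchSwinnertonDyer.Rank1Residual.F1Sign2.IsHondaSystemAtTwo κ (closureEmb (K := ℚ) (v.adicCompletion ℚ)) W
        (W.frobeniusTrace 2) g cneg c) :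
    ∃ z ∈ colemanKer κ (closureEmb (K := ℚ) (v.adicCompletion ℚ)) W (W.frobeniusTrace 2) g c .flat,
      z ⟨g • c 1, smul_mem_localTowerPointsOfEmb κ (closureEmb (K := ℚ) (v.adicCompletion ℚ)) W g
          (localLayerPointsOfEmb_le_localTowerPointsOfEmb κ (closureEmb (K := ℚ) (v.adicCompletion ℚ)) W 1 (hc 1))⟩
        - z ⟨c 1, localLayerPointsOfEmb_le_localTowerPointsOfEmb κ (closureEmb (K := ℚ) (v.adicCompletion ℚ)) W 1 (hc 1)⟩
        = -2 := by
  obtain ⟨z, hz⟩ := hG W hss ha κ hκ v hv g c hg hc hH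
  have hc1 := localLayerPointsOfEmb_le_localTowerPointsOfEmb κ (closureEmb (K := ℚ) (v.adicCompletion ℚ)) W 1 (hc 1)
  have hid := Theorems.OddBlindLocal.evalAt_negTwo_sharp_of_isColemanPair_of_mem hc1 hz
  rw [evalAt_X] at hid
  exact ⟨z, ⟨PowerSeries.X, 0, hz, rfl⟩, hid.symm⟩

end D72BlindGenerator

end Summit.BirchSwinnertonDyer.BirchSwinnertonDyer.Cruxes.SupersingularRankZeroAtTwo

end
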